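import Summits.HodgeConjecture.CorCM.GaloisCertificateQuadraticLift
import Summits.HodgeConjecture.CorCM.GaloisQuadraticStabiliser
import Summits.HodgeConjecture.CorCM.GaloisOcticSimpleCMFourfolds
import HarnessLib

/-!
# BAD ascends along EVERY quadratic extension of a Galois CM field — unconditionally

COR-CM (cell `pub-hodgecm2`), binder seat b04 (gen 32), count-neutral own lane «Galois-CM-type classification»; sequel of
`CorCM/GaloisCertificateQuadraticLift` (gen 31: the lift through a kernel of order two under `|G| ≤ 2^(|Q|/8)` and `Q` not of
exponent two) and of `CorCM/GaloisQuadraticStabiliser` (gen 32: a right translate `w` with `2·|Stab_L(T₀ ∩ T₀w)| ≤ |T₀ ∖ T₀w|`).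
KERNEL ONLY: theorems; no definition, no named fact, no `sorry`.  `HC_CM` is neither used nor claimed.

THE POINT.  In the pattern `𝟙_{T₀} + 𝟙_{T₀w}` (full fibres over `F = T₀ ∩ T₀w`, one point per fibre over `T₀ Δ T₀w`), an element
`v ∈ G` stabilising the lifted set maps full fibres to full fibres, so `f(v) ∈ A := Stab_L(F)` (`stabiliser_mem_leftStab`).  Hence
only the `2(|A| - 1)` elements of `f⁻¹(A ∖ 1)` impose twisted constraints on the section `ε : D₁ → Bool`, and the union bound of
`CorCM/GaloisSectionCount` needs only `(2|A| - 2)·2^(|D₁|/2) < 2^|D₁|`, which holds as soon as `2|A| ≤ |D₁|`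
(`sub_two_mul_two_pow_lt`); `CorCM/GaloisQuadraticStabiliser.exists_good_translate` supplies such a `w` whenever `|T₀| ≥ 5`.

* **`exists_liftQuadratic_certificate_of_card`** — `f : G →* Q` surjective, `ker f = {1, n₁}`, `c² = 1` with `f c` central,
  `|Q| ≥ 10`, an annihilator certificate `(T₀, b₀)` for `(Q, f c)` ⟹ an annihilator certificate for `(G, c)`.  NO size cap, NO
  exponent hypothesis, NO splitting (degrees `≤ 10` carry no certificate: `GaloisOctic.isNondegenerate_of_isPrimitive_of_finrank_le_ten`).
* **`exists_simple_degenerate_of_quadratic_quotient_certificate_of_card`** — Galois dress.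
* **`exists_simple_degenerate_of_subfield_two`** — `K ⊇ K₀` Galois CM, `[K:K₀] = 2`, `K₀` has a primitive degenerate CM type
  ⟹ `K` carries a SIMPLE DEGENERATE abelian variety of dimension `[K:ℚ]/2` with CM by `K`.  UNCONDITIONAL.
With `CorCM/GaloisDegenerateExtension` (degree `≥ 3`) this gives THE MONOTONICITY THEOREM — BAD ascends along EVERY Galois CM
extension `K ⊋ K₀`, GOOD descends to every Galois CM subfield — packaged in the sequel `CorCM/GaloisDegenerateMonotone`.
«BAD» = a primitive degenerate CM type = an exceptional Hodge class on a power of a simple CM abelian variety (algebraicity open).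

## References

* [Kubota1965] T. Kubota, *On the field extension by complex multiplication*, Trans. AMS 118 (1965), §2, §4 Lemma 2.
* [Shimura1998] G. Shimura, *Abelian Varieties with Complex Multiplication and Modular Functions*, §6.2 Thm. 3, §8.2 Prop. 26.
* [Gordon1999HodgeAVSurvey] B. B. Gordon, *A survey of the Hodge conjecture for abelian varieties*, Thm. 6.4, §9.3.
-/

noncomputable section

open CategoryTheory CategoryTheory.Limits NumberField
open scoped BigOperators

namespace Summit.HodgeConjecture.CorCM.GaloisModels

open Literature.NumberTheory.ComplexMultiplication
open Literature.AlgebraicGeometry.Motives (AbelianVariety CMType)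
open Literature.AlgebraicGeometry.HodgeTheory
open Literature.AlgebraicGeometry.ComplexMultiplication (IsCMTypeRealisation)
open Literature.AlgebraicGeometry.Pohlmann1968
open Literature.Barriers.HodgeConjecture (divisorClassesSpan)

namespace QuadraticLift

/-! ## §1 Arithmetic and the stabiliser lemma -/

/-- `(d - 2)·2^(d/2) < 2^d` (natural subtraction; via `2m ≤ 2^m + 1` for `m = ⌈d/2⌉`). [folklore] -/
theorem sub_two_mul_two_pow_lt (d : ℕ) : (d - 2) * 2 ^ (d / 2) < 2 ^ d := by
  have hpow : ∀ m : ℕ, 2 * m ≤ 2 ^ m + 1 := by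
    intro m
    induction m with
    | zero => simp
    | succ m ih =>
      rcases Nat.eq_zero_or_pos m with rfl | hm
      · norm_num
      · have h2 : 2 ^ 1 ≤ 2 ^ m := Nat.pow_le_pow_right two_pos hm
        rw [pow_succ]; omega
  have hsplit : 2 ^ d = 2 ^ (d - d / 2) * 2 ^ (d / 2) := by
    rw [← pow_add, Nat.sub_add_cancel (Nat.div_le_self d 2)]
  rw [hsplit]
  have h1 := hpow (d - d / 2)
  have h2 : 0 < 2 ^ (d - d / 2) := pow_pos two_pos _
  exact mul_lt_mul_of_pos_right (by omega) (pow_pos two_pos _)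

section Model

variable {G Q : Type*} [Group G] [Group Q] {f : G →* Q} {n₁ : G}
variable [Fintype G] [DecidableEq G] [Fintype Q] [DecidableEq Q]

omit [Fintype G] [DecidableEq G] [Fintype Q] in
/-- **A stabiliser of the pattern set lies over `Stab_L(T₀ ∩ T₀w)`**: a fibre containing two points of the pattern set lies over
`F = T₀ ∩ T₀ w`, so a stabiliser maps `F`-fibres to `F`-fibres. [cite: Shimura1998, §8.2 Prop. 26] -/
theorem stabiliser_mem_leftStab (hn₁ : f n₁ = 1) (h₁ : n₁ ≠ 1) (c : G) (T₀ : Finset Q) (w : Q)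
    (P : Q → G) (hP : ∀ q, f (P q) = q) (S : Finset G)
    (hS : ∀ x, x ∈ S ↔ ((f x ∈ T₀ ∧ f x * w⁻¹ ∈ T₀) ∨ (f x ∈ T₀ ∧ f x * w⁻¹ ∉ T₀ ∧ x = P (f x)) ∨
      (f x ∉ T₀ ∧ f x * w⁻¹ ∈ T₀ ∧ x = c * P (f c * f x) * n₁)))
    {v : G} (hstab : ∀ x, x ∈ S ↔ v * x ∈ S) (x : Q) :
    x ∈ T₀.filter (fun q => q * w⁻¹ ∈ T₀) ↔ f v * x ∈ T₀.filter (fun q => q * w⁻¹ ∈ T₀) := by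
  classical
  set F := T₀.filter fun q => q * w⁻¹ ∈ T₀ with hFdef
  have hmF : ∀ q, q ∈ F ↔ q ∈ T₀ ∧ q * w⁻¹ ∈ T₀ := fun q => by rw [hFdef, Finset.mem_filter]
  -- two points of `S` in one fibre: the fibre lies over `F`
  have full : ∀ y : G, y ∈ S → y * n₁ ∈ S → f y ∈ F := by
    intro y hy hy'
    have hfy' : f (y * n₁) = f y := by rw [map_mul, hn₁, mul_one]
    rcases (hS y).1 hy with ⟨e1, e2⟩ | ⟨e1, e2, e3⟩ | ⟨e1, -, e3⟩
    · exact (hmF _).2 ⟨e1, e2⟩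
    · exfalso
      rcases (hS _).1 hy' with ⟨-, e2'⟩ | ⟨-, -, e3'⟩ | ⟨e1', -, -⟩
      · rw [hfy'] at e2'; exact e2 e2'
      · rw [hfy'] at e3'; exact ne_mul_ker h₁ y (e3.trans e3'.symm)
      · rw [hfy'] at e1'; exact e1' e1
    · exfalso
      rcases (hS _).1 hy' with ⟨e1', -⟩ | ⟨e1', -, -⟩ | ⟨-, -, e3'⟩
      · rw [hfy'] at e1'; exact e1 e1'
      · rw [hfy'] at e1'; exact e1 e1'
      · rw [hfy'] at e3'; exact ne_mul_ker h₁ y (e3.trans e3'.symm)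
  have fwd : ∀ q, q ∈ F → f v * q ∈ F := by
    intro q hq
    obtain ⟨hqT, hqw⟩ := (hmF q).1 hq
    have hPq : P q ∈ S := (hS _).2 (Or.inl ⟨by rw [hP]; exact hqT, by rw [hP]; exact hqw⟩)
    have hPq' : P q * n₁ ∈ S :=
      (hS _).2 (Or.inl ⟨by rw [map_mul, hP, hn₁, mul_one]; exact hqT, by rw [map_mul, hP, hn₁, mul_one]; exact hqw⟩)
    have h := full (v * P q) ((hstab _).1 hPq) (by rw [mul_assoc]; exact (hstab _).1 hPq')
    rwa [map_mul, hP] at h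
  have himg : F.image (fun q => f v * q) = F :=
    Finset.eq_of_subset_of_card_le (fun y hy => by obtain ⟨q, hq, rfl⟩ := Finset.mem_image.1 hy; exact fwd q hq)
      (by rw [Finset.card_image_of_injective _ (mul_right_injective _)])
  refine ⟨fwd x, fun h => ?_⟩
  rw [← himg] at h
  obtain ⟨q, hq, e⟩ := Finset.mem_image.1 h
  rw [← mul_right_injective _ e]; exact hq

/-! ## §2 The lift, for every `|Q| ≥ 10` -/

/-- **THE LIFT THROUGH A KERNEL OF ORDER TWO — NO SPLITTING, NO SIZE CAP, NO EXPONENT HYPOTHESIS** (`|Q| ≥ 10`): `f : G →* Q`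
surjective with `ker f = {1, n₁}`, `c ∈ G` with `c² = 1` and `f c` central, an annihilator certificate `(T₀, b₀)` for `(Q, f c)`
⟹ an annihilator certificate for `(G, c)`. [cite: Kubota1965, §2] [cite: Shimura1998, §8.2 Prop. 26] -/
theorem exists_liftQuadratic_certificate_of_card (hf : Function.Surjective f) (hn₁ : f n₁ = 1) (h₁ : n₁ ≠ 1)
    (hker : ∀ n : G, f n = 1 → n = 1 ∨ n = n₁) (c : G) (hcc : c * c = 1) (hcomm : ∀ q : Q, f c * q = q * f c)
    (T₀ : Finset Q) (hcm : ∀ q : Q, q ∈ T₀ ↔ f c * q ∉ T₀)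
    (hprim : ∀ v : Q, v ≠ 1 → ∃ w : Q, ¬ (w ∈ T₀ ↔ v * w ∈ T₀)) (b₀ : Q → ℤ) (hanti : ∀ q, b₀ (f c * q) = -b₀ q)
    (hann : ∀ g : Q, ∑ q ∈ T₀, b₀ (q * g) = 0) (hb : ∃ q, b₀ q ≠ 0) (hQ : 10 ≤ Fintype.card Q) :
    ∃ (S : Finset G) (b : G → ℤ), (∀ x : G, x ∈ S ↔ c * x ∉ S) ∧
      (∀ v : G, v ≠ 1 → ∃ w : G, ¬ (w ∈ S ↔ v * w ∈ S)) ∧ (∀ x, b (c * x) = -b x) ∧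
      (∀ g : G, ∑ x ∈ S, b (x * g) = 0) ∧ ∃ x, b x ≠ 0 := by
  classical
  have hs : ∀ q, f (Function.surjInv hf q) = q := Function.surjInv_eq hf
  set s := Function.surjInv hf with hs_def
  have hcen := SplitExtension.kerTwo_comm hn₁ h₁ hker
  have hinv := SplitExtension.kerTwo_mul_self hn₁ h₁ hker
  have hcc' : f c * f c = 1 := by rw [← map_mul, hcc, map_one]
  have hT₀ := two_mul_card_cm (f c) T₀ hcm
  -- STEP B: the construction for a good `w`
  have key : ∀ w : Q, (∃ q, q ∈ T₀ ∧ q * w⁻¹ ∈ T₀) → (∃ q, q ∈ T₀ ∧ q * w⁻¹ ∉ T₀) →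
      2 * (Finset.univ.filter fun u : Q => ∀ x, x ∈ T₀.filter (fun q => q * w⁻¹ ∈ T₀) ↔
        u * x ∈ T₀.filter (fun q => q * w⁻¹ ∈ T₀)).card ≤ (T₀.filter fun q => q * w⁻¹ ∉ T₀).card →
      ∃ (S : Finset G) (b : G → ℤ), (∀ x : G, x ∈ S ↔ c * x ∉ S) ∧
        (∀ v : G, v ≠ 1 → ∃ w : G, ¬ (w ∈ S ↔ v * w ∈ S)) ∧ (∀ x, b (c * x) = -b x) ∧
        (∀ g : G, ∑ x ∈ S, b (x * g) = 0) ∧ ∃ x, b x ≠ 0 := by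
    intro w hF hD hsmall
    set F := T₀.filter fun q => q * w⁻¹ ∈ T₀ with hFdef
    set A := Finset.univ.filter fun u : Q => ∀ x, x ∈ F ↔ u * x ∈ F with hAdef
    have hmemA : ∀ u, u ∈ A ↔ ∀ x, x ∈ F ↔ u * x ∈ F := fun u => by
      rw [hAdef, Finset.mem_filter, and_iff_right (Finset.mem_univ u)]
    have hA1 : (1 : Q) ∈ A := (hmemA 1).2 fun x => by rw [one_mul]
    set D₁ := T₀.filter fun q => q * w⁻¹ ∉ T₀ with hD₁
    have hmemD₁ : ∀ q, q ∈ D₁ ↔ q ∈ T₀ ∧ q * w⁻¹ ∉ T₀ := fun q => by rw [hD₁, Finset.mem_filter]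
    -- the constraint data
    set ψt : G → Q → Q := fun v z => if f v * z ∈ T₀ then f v * z else f c * (f v * z) with hψt
    set τt : G → Q → Bool := fun v z => if f v * z ∈ T₀ then decide (v * s z ≠ s (f v * z))
      else xor (xor (decide (v * s z ≠ s (f v * z))) (decide (c * s (f c * (f v * z)) ≠ s (f v * z)))) true with hτt
    set V := Finset.univ.filter fun v : G => f v ≠ 1 ∧ f v ≠ f c ∧ (∀ z ∈ D₁, ψt v z ∈ D₁) ∧ f v ∈ A with hV
    have hmemV : ∀ v, v ∈ V ↔ f v ≠ 1 ∧ f v ≠ f c ∧ (∀ z ∈ D₁, ψt v z ∈ D₁) ∧ f v ∈ A := fun v => by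
      rw [hV, Finset.mem_filter, and_iff_right (Finset.mem_univ v)]
    set ψ : G → D₁ → D₁ := fun v z => if h : ψt v z.1 ∈ D₁ then ⟨ψt v z.1, h⟩ else z with hψ
    set τ : G → D₁ → Bool := fun v z => τt v z.1 with hτ
    have hψv : ∀ v ∈ V, ∀ z : D₁, (ψ v z : Q) = ψt v z.1 := fun v hv z => by
      have h := ((hmemV v).1 hv).2.2.1 z.1 z.2
      simp only [hψ, dif_pos h]
    have hψt_cases : ∀ v z, ψt v z = f v * z ∨ ψt v z = f c * (f v * z) := fun v z => by
      simp only [hψt]; split_ifs <;> simp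
    have hinjψ : ∀ v ∈ V, Function.Injective (ψ v) := by
      intro v hv z₁ z₂ h
      have h' : ψt v z₁.1 = ψt v z₂.1 := by rw [← hψv v hv z₁, ← hψv v hv z₂, h]
      apply Subtype.ext
      have hz₁ := ((hmemD₁ _).1 z₁.2).1
      have hz₂ := ((hmemD₁ _).1 z₂.2).1
      simp only [hψt] at h'
      by_cases e₁ : f v * z₁.1 ∈ T₀ <;> by_cases e₂ : f v * z₂.1 ∈ T₀ <;> simp only [e₁, e₂, if_true, if_false] at h'
      · exact mul_left_cancel h'
      · -- `f v z₁ = c₀ f v z₂` ⟹ `z₁ = c₀ z₂`, impossible inside `T₀`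
        have : (z₁ : Q) = f c * z₂ := by
          apply mul_left_cancel (a := f v)
          rw [h', hcomm, mul_assoc, ← hcomm]
        exact absurd hz₁ (this ▸ (hcm _).1 hz₂)
      · have : (z₂ : Q) = f c * z₁ := by
          apply mul_left_cancel (a := f v)
          rw [← h', hcomm, mul_assoc, ← hcomm]
        exact absurd hz₂ (this ▸ (hcm _).1 hz₁)
      · exact mul_left_cancel (mul_left_cancel h')
    have hfixψ : ∀ v ∈ V, ∀ z : D₁, ψ v z ≠ z := by
      intro v hv z h
      have hv' := (hmemV v).1 hv
      have h' : ψt v z.1 = z.1 := by rw [← hψv v hv z, h]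
      simp only [hψt] at h'
      split_ifs at h' with e
      · exact hv'.1 (mul_right_cancel (h'.trans (one_mul (z : Q)).symm))
      · apply hv'.2.1
        have h2 : f c * f v = 1 := by
          have := mul_right_cancel ((mul_assoc (f c) (f v) (z : Q)).trans (h'.trans (one_mul (z : Q)).symm))
          exact this
        calc f v = f c * (f c * f v) := by rw [← mul_assoc, hcc', one_mul]
          _ = f c := by rw [h2, mul_one]
    -- sizes: `V ⊆ f⁻¹(A ∖ 1)`, so `|V| ≤ 2|A| - 2 ≤ |D₁| - 2`
    have hd : Fintype.card D₁ = D₁.card := Fintype.card_coe D₁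
    have hsubV : V ⊆ (A.erase 1).biUnion fun u => ({s u, s u * n₁} : Finset G) := by
      intro v hv
      obtain ⟨hv1, -, -, hvA⟩ := (hmemV v).1 hv
      rw [Finset.mem_biUnion]
      refine ⟨f v, Finset.mem_erase.2 ⟨hv1, hvA⟩, ?_⟩
      rcases fiber_two hker (y := s (f v)) (y' := v) (by rw [hs]) with h | h
      · exact Finset.mem_insert.2 (Or.inl h)
      · exact Finset.mem_insert.2 (Or.inr (Finset.mem_singleton.2 h))
    have hVle : V.card ≤ (A.erase 1).card * 2 :=
      calc V.card ≤ ((A.erase 1).biUnion fun u => ({s u, s u * n₁} : Finset G)).card := Finset.card_le_card hsubV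
        _ ≤ ∑ u ∈ A.erase 1, ({s u, s u * n₁} : Finset G).card := Finset.card_biUnion_le
        _ = (A.erase 1).card * 2 := Finset.sum_const_nat fun u _ => Finset.card_pair (ne_mul_ker h₁ (s u))
    have hbig' : V.card * 2 ^ (Fintype.card D₁ / 2) < 2 ^ Fintype.card D₁ := by
      rw [hd]
      have hA1' := Finset.card_erase_add_one hA1
      calc V.card * 2 ^ (D₁.card / 2) ≤ (D₁.card - 2) * 2 ^ (D₁.card / 2) := Nat.mul_le_mul_right _ (by omega)
        _ < 2 ^ D₁.card := sub_two_mul_two_pow_lt D₁.card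
    obtain ⟨ε, hε⟩ := SectionCount.exists_forall_violated V ψ hinjψ hfixψ τ hbig'
    -- the points and the pattern set
    set εt : Q → Bool := fun q => if h : q ∈ D₁ then ε ⟨q, h⟩ else false with hεt
    have hεt : ∀ z : D₁, εt z.1 = ε z := fun z => by simp only [hεt, dif_pos z.2]
    set S := Finset.univ.filter fun x : G => (f x ∈ T₀ ∧ f x * w⁻¹ ∈ T₀) ∨
      (f x ∈ T₀ ∧ f x * w⁻¹ ∉ T₀ ∧ x = s (f x) * if εt (f x) then n₁ else 1) ∨
      (f x ∉ T₀ ∧ f x * w⁻¹ ∈ T₀ ∧ x = c * (s (f c * f x) * if εt (f c * f x) then n₁ else 1) * n₁) with hSdef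
    have hS : ∀ x, x ∈ S ↔ (f x ∈ T₀ ∧ f x * w⁻¹ ∈ T₀) ∨
        (f x ∈ T₀ ∧ f x * w⁻¹ ∉ T₀ ∧ x = s (f x) * if εt (f x) then n₁ else 1) ∨
        (f x ∉ T₀ ∧ f x * w⁻¹ ∈ T₀ ∧ x = c * (s (f c * f x) * if εt (f c * f x) then n₁ else 1) * n₁) := fun x => by
      rw [hSdef, Finset.mem_filter, and_iff_right (Finset.mem_univ x)]
    have hP : ∀ q, f (s q * if εt q then n₁ else 1) = q := fun q => by
      rw [map_mul, hs]; split_ifs <;> simp [hn₁]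
    refine ⟨S, fun x => b₀ (f x), pattern_cm h₁ hker c hcc T₀ hcm w (fun q => s q * if εt q then n₁ else 1) hP S hS, ?_,
      fun x => by show b₀ (f (c * x)) = -b₀ (f x); rw [map_mul, hanti],
      pattern_annihilated hs hn₁ h₁ hker c hcc T₀ b₀ hann w (fun q => s q * if εt q then n₁ else 1) hP S hS, ?_⟩
    · -- trivial left stabiliser
      intro v hv
      by_contra H
      have hstab : ∀ x, x ∈ S ↔ v * x ∈ S := fun x => by by_contra h; exact H ⟨x, h⟩
      by_cases hfv : f v = 1
      · -- `v = n₁` moves the point over `D₁`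
        have hvn : v = n₁ := (hker v hfv).resolve_left hv
        obtain ⟨z, hz, hzw⟩ := hD
        have hpS : (s z * if εt z then n₁ else 1) ∈ S :=
          (hS _).2 (Or.inr (Or.inl ⟨by rw [hP]; exact hz, by rw [hP]; exact hzw, by rw [hP]⟩))
        have hnot : v * (s z * if εt z then n₁ else 1) ∉ S := by
          rw [hvn, ← hcen]
          intro h
          rcases (hS _).1 h with ⟨-, h2⟩ | ⟨-, -, h3⟩ | ⟨h1', -, -⟩
          · rw [map_mul, hP, hn₁, mul_one] at h2; exact hzw h2
          · rw [map_mul, hP, hn₁, mul_one] at h3; exact ne_mul_ker h₁ _ h3.symm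
          · rw [map_mul, hP, hn₁, mul_one] at h1'; exact h1' hz
        exact hnot ((hstab _).1 hpS)
      by_cases hfc : f v = f c
      · rcases fiber_two hker hfc with hvc | hvc
        · -- `v = c`
          have h1 := pattern_cm h₁ hker c hcc T₀ hcm w (fun q => s q * if εt q then n₁ else 1) hP S hS 1
          have h2 := hstab 1
          rw [hvc] at h2
          exact (iff_iff_and_or_not_and_not.1 h2).elim (fun h => (h1.1 h.1) h.2) (fun h => h.1 (h1.2 h.2))
        · -- `v = c n₁` moves a full fibre over `F` onto an empty one
          obtain ⟨q, hq, hqw⟩ := hF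
          have hxS : s q ∈ S := (hS _).2 (Or.inl ⟨by rw [hs]; exact hq, by rw [hs]; exact hqw⟩)
          have hfx : f (v * s q) = f c * q := by rw [hvc, map_mul, map_mul, hn₁, mul_one, hs]
          have hnot : v * s q ∉ S := by
            intro h
            rcases (hS _).1 h with ⟨h1', -⟩ | ⟨h1', -, -⟩ | ⟨-, h2', -⟩
            · rw [hfx] at h1'; exact (hcm q).1 hq h1'
            · rw [hfx] at h1'; exact (hcm q).1 hq h1'
            · rw [hfx, mul_assoc] at h2'; exact (hcm _).1 hqw h2'
          exact hnot ((hstab _).1 hxS)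
      · -- generic `v`: it lies in `V` and satisfies all equations — contradiction with the choice of `ε`
        have hcons : ∀ z, z ∈ T₀ → z * w⁻¹ ∉ T₀ →
            ψt v z ∈ T₀ ∧ ψt v z * w⁻¹ ∉ T₀ ∧ εt (ψt v z) = xor (εt z) (τt v z) := fun z hz hzw =>
          constraint_of_stabiliser hs hn₁ h₁ hker hinv c hcc T₀ hcm w εt S hS hstab hz hzw
        have hvV : v ∈ V := by
          rw [hmemV]
          refine ⟨hfv, hfc, fun z hzD => ?_, (hmemA _).2 (stabiliser_mem_leftStab hn₁ h₁ c T₀ w _ hP S hS hstab)⟩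
          rw [hmemD₁] at hzD ⊢
          obtain ⟨h1, h2, -⟩ := hcons z hzD.1 hzD.2
          exact ⟨h1, h2⟩
        obtain ⟨z, hzne⟩ := hε v hvV
        obtain ⟨hz, hzw⟩ := (hmemD₁ _).1 z.2
        obtain ⟨h1, h2, h3⟩ := hcons z.1 hz hzw
        apply hzne
        have e1 : ε (ψ v z) = εt (ψt v z.1) := by rw [← hεt (ψ v z), hψv v hvV z]
        rw [e1, ← hεt z, h3]
    · obtain ⟨q, hq⟩ := hb
      exact ⟨s q, by show b₀ (f (s q)) ≠ 0; rw [hs]; exact hq⟩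
  -- STEP A: a usable `w` with `2|Stab_L(T₀ ∩ T₀w)| ≤ |T₀ ∖ T₀w|` (`CorCM/GaloisQuadraticStabiliser`)
  have h5 : 5 ≤ T₀.card := by omega
  obtain ⟨w, hF, hD, hsmall⟩ := QuadraticStabiliser.exists_good_translate (f c) hcc' hcomm T₀ hcm hprim h5
  exact key w hF hD hsmall


end Model

end QuadraticLift

/-! ## §3 The theorems for Galois CM fields -/

section Field

variable {K : Type} [Field K] [NumberField K] [IsCMField K] [IsGalois ℚ K]

/-- **A CERTIFIED-BAD QUOTIENT OF INDEX TWO MAKES THE FIELD BAD** (`|Q₀| ≥ 10`; no splitting, no size cap, no exponent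
hypothesis).  `e : Gal(K/ℚ) ≃* G₀`, `f : G₀ →* Q₀` surjective with kernel `{1, n₁}`, an annihilator certificate for
`(Q₀, f (e c))` ⟹ `K` carries a SIMPLE DEGENERATE abelian variety of dimension `|G₀|/2` with CM by `K`.
[cite: Kubota1965, §2 and §4 Lemma 2] [cite: Shimura1998, §6.2 Thm. 3 and §8.2 Prop. 26] [cite: Gordon1999HodgeAVSurvey, Thm. 6.4 and §9.3] -/
theorem exists_simple_degenerate_of_quadratic_quotient_certificate_of_card {G₀ Q₀ : Type*} [Group G₀] [Fintype G₀]
    [DecidableEq G₀] [Group Q₀] [Fintype Q₀] [DecidableEq Q₀] (e : (K ≃ₐ[ℚ] K) ≃* G₀) (f : G₀ →* Q₀)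
    (hf : Function.Surjective f) {n₁ : G₀} (hn₁ : f n₁ = 1) (h₁ : n₁ ≠ 1) (hker : ∀ n : G₀, f n = 1 → n = 1 ∨ n = n₁)
    (hQ : 10 ≤ Fintype.card Q₀) (c₀ : Q₀) (hc : f (e ((IsCMField.complexConj K).restrictScalars ℚ)) = c₀) (T₀ : Finset Q₀)
    (hcm : ∀ q : Q₀, q ∈ T₀ ↔ c₀ * q ∉ T₀) (hprim : ∀ v : Q₀, v ≠ 1 → ∃ w : Q₀, ¬ (w ∈ T₀ ↔ v * w ∈ T₀))
    (b₀ : Q₀ → ℤ) (hanti : ∀ q, b₀ (c₀ * q) = -b₀ q) (hann : ∀ g : Q₀, ∑ q ∈ T₀, b₀ (q * g) = 0)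
    (hb : ∃ q, b₀ q ≠ 0) :
    ∃ (Φ : CMType K) (φ₀ : K →+* ℂ) (X : AbelianVariety ℂ) (ι : 𝓞 K →+* End X)
      (ϑ : K →+* Module.End ℂ (complexBetti X.X 1)),
      IsPrimitive (ℂ ≃+* ℂ) Φ.1 φ₀ ∧ ¬ IsNondegenerate Φ ∧ IsCMTypeRealisation Φ X ι ϑ ∧ X.IsSimple ∧
      X.dim = Fintype.card G₀ / 2 ∧
      ∃ m p : ℕ, ∃ y : complexBetti (⨁ fun _ : Fin m => X).X (2 * p), IsRationalClass y ∧
        IsOfHodgeType (⨁ fun _ : Fin m => X).dim (⨁ fun _ : Fin m => X).X (2 * p) p p y ∧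
        y ∉ divisorClassesSpan (⨁ fun _ : Fin m => X).X (⨁ fun _ : Fin m => X).dim p := by
  subst hc
  set c := e ((IsCMField.complexConj K).restrictScalars ℚ) with hc_def
  have hcc : c * c = 1 := GaloisRank.model_complexConj_mul_self e rfl
  have hcomm : ∀ q : Q₀, f c * q = q * f c := fun q => by
    obtain ⟨y, rfl⟩ := hf q
    rw [← map_mul, ← map_mul, GaloisRank.model_complexConj_comm e rfl y]
  obtain ⟨S, b, hcm', hprim', hanti', hann', hb'⟩ :=
    QuadraticLift.exists_liftQuadratic_certificate_of_card hf hn₁ h₁ hker c hcc hcomm T₀ hcm hprim b₀ hanti hann hb hQ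
  exact exists_simple_degenerate_of_model_annihilator e c rfl S hcm' hprim' b hanti' hann' hb'

/-- **BAD ASCENDS ALONG EVERY QUADRATIC EXTENSION OF A GALOIS CM FIELD — unconditionally.**  `K ⊇ K₀ ⊇ ℚ` Galois CM with
`[K : K₀] = 2`; if `K₀` has a PRIMITIVE DEGENERATE CM type then `K` carries a SIMPLE DEGENERATE abelian variety of dimension `[K:ℚ]/2`
with CM by `K` (a rational `(p,p)` class outside the divisor ring on some power).  Degrees `[K₀:ℚ] ≤ 10` carry no primitive degenerate
type (tree `GaloisOctic.isNondegenerate_of_isPrimitive_of_finrank_le_ten`), larger degrees go through the lift.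
[cite: Kubota1965, §2 and §4 Lemma 2] [cite: Shimura1998, §6.2 Thm. 3 and §8.2 Prop. 26] [cite: Gordon1999HodgeAVSurvey, Thm. 6.4 and §9.3] -/
theorem exists_simple_degenerate_of_subfield_two (K₀ : Type) [Field K₀] [NumberField K₀] [IsCMField K₀] [IsGalois ℚ K₀]
    [Algebra K₀ K] [IsScalarTower ℚ K₀ K] (hdeg : Module.finrank K₀ K = 2)
    (Φ₀ : CMType K₀) (φ₀ : K₀ →+* ℂ) (hprim : IsPrimitive (ℂ ≃+* ℂ) Φ₀.1 φ₀) (hndg : ¬ IsNondegenerate Φ₀) :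
    ∃ (Φ : CMType K) (φ : K →+* ℂ) (X : AbelianVariety ℂ) (ι : 𝓞 K →+* End X)
      (ϑ : K →+* Module.End ℂ (complexBetti X.X 1)),
      IsPrimitive (ℂ ≃+* ℂ) Φ.1 φ ∧ ¬ IsNondegenerate Φ ∧ IsCMTypeRealisation Φ X ι ϑ ∧ X.IsSimple ∧
      X.dim = Module.finrank ℚ K / 2 ∧
      ∃ m p : ℕ, ∃ y : complexBetti (⨁ fun _ : Fin m => X).X (2 * p), IsRationalClass y ∧
        IsOfHodgeType (⨁ fun _ : Fin m => X).dim (⨁ fun _ : Fin m => X).X (2 * p) p p y ∧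
        y ∉ divisorClassesSpan (⨁ fun _ : Fin m => X).X (⨁ fun _ : Fin m => X).dim p := by
  classical
  -- small degrees carry no primitive degenerate type
  by_cases h10 : Module.finrank ℚ K₀ ≤ 10
  · exact absurd (GaloisOctic.isNondegenerate_of_isPrimitive_of_finrank_le_ten h10 (fun _ => inferInstance) φ₀ hprim) hndg
  obtain ⟨τ, hτ, hker⟩ := eq_one_or_eq_of_restrictNormalHom_eq_one K₀ hdeg
  have hone : ((1 : K ≃ₐ[K₀] K).restrictScalars ℚ : K ≃ₐ[ℚ] K) = 1 := AlgEquiv.ext fun x => rfl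
  have h₁ : (τ.restrictScalars ℚ : K ≃ₐ[ℚ] K) ≠ 1 := fun h =>
    hτ (AlgEquiv.restrictScalars_injective ℚ (h.trans hone.symm))
  have hn₁ := restrictNormalHom_restrictScalars_eq_one K₀ τ
  obtain ⟨T₀, b, -, hcm, hprim', hanti, hann, hb⟩ :=
    exists_certificate_of_not_isNondegenerate (MulEquiv.refl (K₀ ≃ₐ[ℚ] K₀))
      (c₀ := (IsCMField.complexConj K₀).restrictScalars ℚ) rfl Φ₀ φ₀ hprim hndg
  have hQ : 10 ≤ Fintype.card (K₀ ≃ₐ[ℚ] K₀) := by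
    rw [GaloisRank.card_model_eq_finrank (MulEquiv.refl (K₀ ≃ₐ[ℚ] K₀))]; omega
  obtain ⟨Φ, φ, X, ι, ϑ, H1, H2, H3, H4, H5, H6⟩ :=
    exists_simple_degenerate_of_quadratic_quotient_certificate_of_card (MulEquiv.refl (K ≃ₐ[ℚ] K))
      (AlgEquiv.restrictNormalHom K₀) (AlgEquiv.restrictNormalHom_surjective K) hn₁ h₁ hker hQ
      ((IsCMField.complexConj K₀).restrictScalars ℚ) (by rw [MulEquiv.refl_apply, restrictNormalHom_complexConj_of_tower K₀])
      T₀ hcm hprim' b hanti hann hb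
  refine ⟨Φ, φ, X, ι, ϑ, H1, H2, H3, H4, ?_, H6⟩
  rw [H5, GaloisRank.card_model_eq_finrank (MulEquiv.refl (K ≃ₐ[ℚ] K))]

end Field

end Summit.HodgeConjecture.CorCM.GaloisModels

end
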